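import Summits.QuantumFields.BalabanUV.T4Continuum.Support.ShellMeasureWilsonSquare
import Summits.QuantumFields.BalabanUV.T4Continuum.Support.ShellMeasureLandauHolonomySkew
import Summits.QuantumFields.BalabanUV.T4Continuum.Support.ShellMeasureLandauPinnedFixedPoint

/-!
# `T4Continuum.ShellMeasureLandauWilsonSquares` — row S74: THE WILSON PART AS SQUARE TERMS IN END-II
# (owner finding F-ne7cp1-g31-1 «END-II of record is scale-blind»; the Wilson plaquette densities routed through END-II's
# non-Wilson ray binder `hE` as analytic SQUARE terms, by ONE CALL of S72 `hE_of_wilsonSquares`)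
(cell `pub-balaban`, sub-cell `t4`, spine estimate NE7c (node U5b); NE7c ROUND-2 crew, unit
`b2b-balaban-t4-ne7c-formalise-leaf-09` gen 11 (S71 holder); owner table `t4/b2b-balaban-t4-ne7c-p1/LEAVES-NE7c-P1.md` row
S74 (journal CLAIM l.16793); ADDITIVE — imports S72 `ShellMeasureWilsonSquare` (owner g31, p225012: `wilsonSq`,
`hE_of_wilsonSquares`), the LD chain's (E) `ShellMeasureLandauHolonomySkew` (`readOutReal`, the matrix instance; hence (B)
`ShellMeasureLandauHolonomyWeight`: `landauCurve_along`, (A) `landauField_mem_real`, 7″ `rayData_chart`) and leaf-07-g6's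
`ShellMeasureLandauPinnedFixedPoint` (`solAt_zero_zero`, `landauExp_zero`: the flat centre `Z(0) = 0`) ONLY; [folklore];
0 `def`, 0 `def … : Prop`, 0 sorry, 0 citations)

HONEST FRAMING.  Finite four-torus programme, rung (B)+1 only — NOT infinite volume, NOT a mass gap, NOT the Clay
problem, NOT summit progress; (B), `BetaPertHyp`, (B^μ) not consumed.  NE7c (`T4IndicatorShell.ShellWeightBound`) is
NOT PRINTED in [Balaban 1983–89] and NOT PROVED; «NE7c ⇐ the named binders» (trigger c3).  Nothing printed is asserted;
no estimate of Bałaban's is discharged; a RE-WIRING of OUR END-II's Wilson slot on OUR side.  HONEST DEPENDENCY (cell):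
continuum YM on T⁴ ⇐ BetaPertH ∧ nine spine estimates (0/9 proved); BetaPertH ⇐ (D1) ∧ (D4) ∧ CAP+tail; G-an2-4 gates
asym, D1 and NE2/3/4.

THE POINT (F-ne7cp1-g31-1 (ii), GAPS l.25753; owner row S74).  END-II of record carries the Wilson part of the sectioned
log-weight as WORDS (`hGW`: per weight plaquette `p` a word of unitary-type letters with sizes `s̄_p` and ray-Lipschitz
constants `L̄_p`, cost `β Σ_p L̄_p(d̄_p + 4s̄_p)` — FIRST ORDER in the letter size, hence `∝ η_j^{−2}` over the block's fine
plaquettes).  Print's Wilson density `β(1 − Re tr U_p∕N)` is SECOND ORDER in the plaquette variable `U_p − 1` (unitarity: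
`N − Re tr U = ½‖U − 1‖²_F`), and the owner's S72 types that: `wilsonSq β E w = (β∕2N) tr(E(w)E(w̄)ᴴ)`, holomorphic,
`= β(1 − Re tr(1 + E c)∕N)` at unitary points of the real ray, oscillation `≤ |β|·H·O`; `hE_of_wilsonSquares` turns a
finite family of such curves into END-II's `hE` by ONE CALL of S16.  THIS FILE supplies the curves FROM THE LD CHAIN:
* §1 (any complete normed algebra) THE PLAQUETTE CURVE OF LETTER CURVES `E = plaquetteFn Xs` (gen-9
  `T4ShellMeasurePlaquette`: `e^{X₁(w)}⋯e^{X_m(w)} − 1`): holomorphic where the letters are; flat centre `E 0 = 0` when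
  the letters vanish at `0`; the STOKES-CURRENCY bound `‖E w‖ ≤ s₁ + expTail₂(m·a)` from per-letter bounds `a` and a
  bound `s₁` on the LETTER SUM (the curl — the linearised plaquette variable, `∝ η²` in B11's (25)∕(37) reading; a
  DISPLAYED binder); so SUP = OSCILLATION `H = O = s₁ + expTail₂(m·a)` (`norm_plaquetteFn_osc_le`).
* §2 (`M_N(ℂ)`, operator norm) UNITARITY ON THE REAL RAY FROM SKEW LETTERS and a FROZEN unitary prefactor `B` (the
  background plaquette at the chart centre, owner N-ne7cp1-g31-2): `(l.map exp).prod ∈ unitary` for skew-adjoint letters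
  (Mathlib `NormedSpace.exp_mem_unitary_of_mem_skewAdjoint`), hence for `E := B(1 + plaquetteFn) − 1`: `(1 + E c)(1 + E c)ᴴ = 1`
  (S72's `hunit`), `‖E w‖ ≤ ‖B − 1‖ + ‖plaquetteFn w‖`, `‖E w − E 0‖ = ‖plaquetteFn w − plaquetteFn 0‖` (`‖B·M‖ = ‖M‖`).
* §3 **`hE_of_wilsonPlaquettes`** — the ABSTRACT END: per window point finitely many plaquettes, each a list of `≤ m`
  letter curves holomorphic on the disc `‖w‖ < R` (`R > 1`), vanishing at `0`, bounded by `a x p`, letter sum bounded by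
  `s₁ x p`, SKEW-ADJOINT on `[0,1]`, and a frozen unitary prefactor `Bf x p`, `‖Bf x p − 1‖ ≤ d x p`; budget
  `Σ_p |β|·(d + S)·S ≤ H̄`, `S = s₁ + expTail₂(m a)`; dictionary `𝓔(c•x) = Σ_p β(1 − Re tr(Bf x p·e^{X₁(c)}⋯e^{X_m(c)})∕N)` ⟹
  END-II's `hE` with `B_𝓔 = 3H̄∕(R−1)` (S72 BY NAME).
* §4 **`hE_landau_wilsonSquares`** — THE CHART-RAY INSTANCE ON THE LD CHAIN, the analogue of (B)
  `hGW_landau_chartRay` with the Wilson part read through `hE`: the weight read-outs `ℓw p` (op-norm `≤ κ_w p`) AND ONE MORE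
  DISPLAYED binder, the CURL read-out norm `‖(Σ_{ℓ∈ℓw p} ℓ) Y‖ ≤ κ_c p·‖Y‖` (F-g31-1 (A): `κ_c ∝ η²`); the chain's point∕ray
  binders VERBATIM ((P2) `h𝒢`, (P4) `hW`, (118)∕(121), (103) `hH₁`, (75) `hΦ…`, (44) `hCq`∕`hCd`, scaling `hι`, (46) `hH`,
  (54) `hq`∕`hRC`); the real structure with SKEW weight read-outs (`readOutReal`-type binder `hskew`, the chain's (A)∕(E));
  ⟹ END-II's `hE` for the DEFINED Wilson ray profile `𝓔_W y := Σ_{p∈P_w} β(1 − Re tr(holOf (ℓw p) Z y)∕N)` with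
  `B_𝓔 = 3H̄∕(r_Φ∕S − 1)`, `H̄ ≥ Σ_p |β|·(κ_c p·z̄ + expTail₂(m_w κ_w p z̄))²`, `z̄ = (ε₄+B₀b) + 4C₂B₀(ε₄+B₀b)²` — the per-plaquette
  cost is SECOND ORDER in (curl, letter²): with `κ_c p, κ_w p² ∝ η²` it is `∝ β η⁴` (S72 `squareBudget_le`: η-free over the
  block); far plaquettes: `κ_c p, κ_w p` carry the pin `e^{−δ′ϖ(p)}` in S69's pinned reading (S70∕S71) — DISPLAYED here.
* §5 `hE_add` — two ray bounds ADD (`B_𝓔 = B_W + B_E`): the Wilson squares (§4) + the genuine non-Wilson terms (S71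
  `hE_of_pinned_terms` ∕ f2 `hE_landau_chartRay_pinned`, or (D) `hE_landau_chartRay`) give ONE pair for (C)
  `slotAC_realized_su2_landauChart_twoSided` ∕ S70 f4 `…_pinned_rayE`, with `P_w := ∅` on the words side (S72 `action_empty`).
DISPLAYED, NOT DISCHARGED (c2): every chain binder; `κ_w p`, `κ_c p` (the curl read-out norm — B11 (19) n = 1 ∕ (25) ∕ (37)
TYPE, LOCATOR only); the skew∕real structure; the budget `H̄`; the dictionary `hRdict` reading `𝓔_W` as the Wilson factor
(node O).  NE7c NOT PROVED; spine PROVED 0∕9.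
-/

noncomputable section

open Set Metric NormedSpace
open scoped Matrix

namespace Summit.QuantumFields.BalabanUV.T4Continuum.ShellMeasureLandauWilsonSquares

open Literature.MathematicalPhysics.QuantumFieldTheory.Balaban1983to89
open B11Prop6Scheme (Prop4Hyp)
open T4ShellMeasurePlaquette (plaquetteFn plaquetteFn_eq plaquetteFn_apply_zero differentiableOn_plaquetteFn
  norm_plaquetteFn_le_of_uniform expTail₂ expTail₂_nonneg)
open Summit.QuantumFields.BalabanUV.T4Continuum.ShellMeasureWilsonWords (wordExp)
open Summit.QuantumFields.BalabanUV.T4Continuum.ShellMeasureWilsonSquare (wilsonSq hE_of_wilsonSquares)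
open Summit.QuantumFields.BalabanUV.T4Continuum.ShellMeasureLandauExponent (currentData_zero)
open Summit.QuantumFields.BalabanUV.T4Continuum.ShellMeasureLandauHolonomy (solAt landauExp)
open Summit.QuantumFields.BalabanUV.T4Continuum.ShellMeasureLandauHolonomyChart (holOf holOf_apply cplx cplx_zero
  ofReal_smul_cplx rayData_chart)
open Summit.QuantumFields.BalabanUV.T4Continuum.ShellMeasureLandauHolonomyWeight (landauCurve_along)
open Summit.QuantumFields.BalabanUV.T4Continuum.ShellMeasureLandauHolonomyReal (landauField_mem_real)
open Summit.QuantumFields.BalabanUV.T4Continuum.ShellMeasureLandauPinnedFixedPoint (solAt_zero_zero landauExp_zero)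
open Summit.QuantumFields.BalabanUV.T4Continuum.ShellMeasureRayWiring (rayConst_nonneg)

/-! ## §1 The plaquette curve of a list of letter curves: holomorphy, flat centre, Stokes-currency sup = oscillation -/

section Curve

variable {A : Type*} [NormedRing A] [NormedAlgebra ℂ A] [CompleteSpace A]

/-- **SUP = OSCILLATION IN THE STOKES CURRENCY.**  Letter curves `Xs` on the disc `‖w‖ < R` with `X 0 = 0`, per-letter
bound `‖X w‖ ≤ a` (`a ≥ 0`), letter-sum (curl) bound `‖Σ_X X w‖ ≤ s₁`, at most `m` letters ⟹ the plaquette curve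
`E = plaquetteFn Xs` has `E 0 = 0` and `‖E w‖, ‖E w − E 0‖ ≤ s₁ + expTail₂(m·a)` on the disc (gen-9
`norm_plaquetteFn_le_of_uniform` — the linear term kept as the NORM OF THE SUM). [folklore] -/
theorem norm_plaquetteFn_osc_le (Xs : List (ℂ → A)) {R a s₁ : ℝ} {m : ℕ} (ha0 : 0 ≤ a) (hlen : Xs.length ≤ m)
    (h0 : ∀ X ∈ Xs, X 0 = 0) (ha : ∀ X ∈ Xs, ∀ w ∈ ball (0 : ℂ) R, ‖X w‖ ≤ a)
    (hs : ∀ w ∈ ball (0 : ℂ) R, ‖(Xs.map fun X => X w).sum‖ ≤ s₁) :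
    plaquetteFn Xs 0 = 0 ∧ (∀ w ∈ ball (0 : ℂ) R, ‖plaquetteFn Xs w‖ ≤ s₁ + expTail₂ (m * a)) ∧
      ∀ w ∈ ball (0 : ℂ) R, ‖plaquetteFn Xs w - plaquetteFn Xs 0‖ ≤ s₁ + expTail₂ (m * a) := by
  have hz : plaquetteFn Xs 0 = 0 := plaquetteFn_apply_zero h0
  have hsup : ∀ w ∈ ball (0 : ℂ) R, ‖plaquetteFn Xs w‖ ≤ s₁ + expTail₂ (m * a) := fun w hw =>
    norm_plaquetteFn_le_of_uniform (fun X hX => ha X hX w hw) (hs w hw) ha0 hlen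
  exact ⟨hz, hsup, fun w hw => by rw [hz, sub_zero]; exact hsup w hw⟩

omit [NormedAlgebra ℂ A] [CompleteSpace A] in
/-- `1 + plaquetteFn Xs w` IS the word of exponentials of the letter values. [folklore] -/
theorem one_add_plaquetteFn (Xs : List (ℂ → A)) (w : ℂ) :
    1 + plaquetteFn Xs w = ((Xs.map fun X => X w).map exp).prod := by
  rw [plaquetteFn_eq]; abel

end Curve

/-! ## §2 `M_N(ℂ)`: unitarity on the real ray from skew-adjoint letters -/

section Unitary

open scoped Matrix.Norms.L2Operator

variable {n : Type*} [Fintype n] [DecidableEq n]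

/-- A word of exponentials of SKEW-ADJOINT matrices is UNITARY (Mathlib `NormedSpace.exp_mem_unitary_of_mem_skewAdjoint`,
`unitary` is a submonoid). [folklore] -/
theorem listProd_exp_mem_unitary :
    ∀ l : List (Matrix n n ℂ), (∀ Y ∈ l, Y ∈ skewAdjoint (Matrix n n ℂ)) → (l.map exp).prod ∈ unitary (Matrix n n ℂ)
  | [], _ => by simp
  | Y :: l, h => by
    letI : NormedAlgebra ℚ (Matrix n n ℂ) := NormedAlgebra.restrictScalars ℚ ℂ (Matrix n n ℂ)
    rw [List.map_cons, List.prod_cons]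
    exact (unitary (Matrix n n ℂ)).mul_mem (exp_mem_unitary_of_mem_skewAdjoint (h Y (by simp)))
      (listProd_exp_mem_unitary l fun Z hZ => h Z (List.mem_cons_of_mem _ hZ))

/-- **S72's `hunit` FROM SKEW LETTERS AND A FROZEN UNITARY PREFACTOR** (owner N-ne7cp1-g31-2: the background
plaquette `B_p ≠ 1` at the chart centre): if `B` is unitary and every letter value `X c` (`X ∈ Xs`) is skew-adjoint then the
curve `E w := B·(1 + plaquetteFn Xs w) − 1` has `(1 + E c)(1 + E c)ᴴ = 1`. [folklore] -/
theorem one_add_curve_mul_conjTranspose {B : Matrix n n ℂ} (hB : B ∈ unitary (Matrix n n ℂ))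
    {Xs : List (ℂ → Matrix n n ℂ)} {c : ℂ} (hskew : ∀ X ∈ Xs, X c ∈ skewAdjoint (Matrix n n ℂ)) :
    (1 + (B * (1 + plaquetteFn Xs c) - 1)) * (1 + (B * (1 + plaquetteFn Xs c) - 1))ᴴ = 1 := by
  rw [add_sub_cancel, one_add_plaquetteFn]
  have hu := (unitary (Matrix n n ℂ)).mul_mem hB (listProd_exp_mem_unitary (Xs.map fun X => X c)
    (fun Y hY => by obtain ⟨X, hX, rfl⟩ := List.mem_map.1 hY; exact hskew X hX))
  have h := Unitary.mul_star_self_of_mem hu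
  rwa [Matrix.star_eq_conjTranspose] at h

/-- The curve's size and oscillation: `‖B(1 + P w) − 1‖ ≤ ‖B − 1‖ + ‖P w‖` and `‖(B(1+P w) − 1) − (B(1+P 0) − 1)‖ = ‖P w − P 0‖`
for unitary `B` (`‖B·M‖ = ‖M‖`, C⋆-norm of `M_N(ℂ)`). [folklore] -/
theorem norm_curve_le [Nonempty n] {B : Matrix n n ℂ} (hB : B ∈ unitary (Matrix n n ℂ)) (P : ℂ → Matrix n n ℂ)
    (w : ℂ) :
    ‖B * (1 + P w) - 1‖ ≤ ‖B - 1‖ + ‖P w‖ ∧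
      ‖(B * (1 + P w) - 1) - (B * (1 + P 0) - 1)‖ = ‖P w - P 0‖ := by
  have hmul : ∀ M : Matrix n n ℂ, ‖B * M‖ = ‖M‖ := fun M => CStarRing.norm_coe_unitary_mul ⟨B, hB⟩ M
  refine ⟨?_, ?_⟩
  · calc ‖B * (1 + P w) - 1‖ = ‖(B - 1) + B * P w‖ := by congr 1; noncomm_ring
      _ ≤ ‖B - 1‖ + ‖B * P w‖ := norm_add_le _ _
      _ = ‖B - 1‖ + ‖P w‖ := by rw [hmul]
  · have e : (B * (1 + P w) - 1) - (B * (1 + P 0) - 1) = B * (P w - P 0) := by noncomm_ring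
    rw [e, hmul]

end Unitary

/-! ## §3 The abstract END: END-II's `hE` from Wilson plaquettes given as lists of letter curves -/

section AbstractEnd

open scoped Matrix.Norms.L2Operator

variable {n : Type*} [Fintype n] [DecidableEq n] [Nonempty n]
variable {E𝔠 : Type*} [AddCommGroup E𝔠] [Module ℝ E𝔠]

/-- **END-II's `hE` FROM WILSON PLAQUETTES AS SQUARE TERMS (abstract).**  Per window point `x ∈ W` a finite plaquette set
`P x`; per plaquette a FROZEN unitary prefactor `Bf x p` with `‖Bf x p − 1‖ ≤ d x p` (the background plaquette at the chart
centre, N-ne7cp1-g31-2; `Bf = 1`, `d = 0` in the flat case) and a list `Xs x p` of at most `m` letter curves `ℂ → M_N(ℂ)`,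
each holomorphic on `‖w‖ < R` (`R > 1`), vanishing at `0`, bounded by `a x p ≥ 0`, with letter-sum (curl) bound `s₁ x p` on
the disc and SKEW-ADJOINT values on the real segment `[0,1]`; the budget
`Σ_{p∈P x} |β|·(d x p + S x p)·S x p ≤ H̄`, `S := s₁ + expTail₂(m·a)`; the dictionary
`𝓔(c•x) = Σ_p β·(1 − Re tr(Bf x p·e^{X₁(c)}⋯e^{X_m(c)})∕N)`.  CONCLUSION — LITERALLY END-II's binder:
`∀ x ∈ W, ∀ c, ½ ≤ c → c ≤ 1 → 𝓔(c•x) ≤ 𝓔 x + (1 − c)·(3H̄∕(R−1))` (S72 `hE_of_wilsonSquares` with the curves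
`E := Bf·(1 + plaquetteFn Xs) − 1`, `H := d + S`, `O := S`). [folklore] -/
theorem hE_of_wilsonPlaquettes {W : Set E𝔠} {ι : Type*} (P : E𝔠 → Finset ι) (Bf : E𝔠 → ι → Matrix n n ℂ)
    (Xs : E𝔠 → ι → List (ℂ → Matrix n n ℂ)) {R β Hbar : ℝ} {d a s₁ : E𝔠 → ι → ℝ} {m : ℕ} (hR : 1 < R)
    (hBu : ∀ x ∈ W, ∀ p ∈ P x, Bf x p ∈ unitary (Matrix n n ℂ)) (hBd : ∀ x ∈ W, ∀ p ∈ P x, ‖Bf x p - 1‖ ≤ d x p)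
    (hlen : ∀ x ∈ W, ∀ p ∈ P x, (Xs x p).length ≤ m)
    (hXd : ∀ x ∈ W, ∀ p ∈ P x, ∀ X ∈ Xs x p, DifferentiableOn ℂ X (ball 0 R))
    (hX0 : ∀ x ∈ W, ∀ p ∈ P x, ∀ X ∈ Xs x p, X 0 = 0)
    (ha0 : ∀ x ∈ W, ∀ p ∈ P x, 0 ≤ a x p)
    (ha : ∀ x ∈ W, ∀ p ∈ P x, ∀ X ∈ Xs x p, ∀ w ∈ ball (0 : ℂ) R, ‖X w‖ ≤ a x p)
    (hs : ∀ x ∈ W, ∀ p ∈ P x, ∀ w ∈ ball (0 : ℂ) R, ‖((Xs x p).map fun X => X w).sum‖ ≤ s₁ x p)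
    (hskew : ∀ x ∈ W, ∀ p ∈ P x, ∀ c : ℝ, 0 ≤ c → c ≤ 1 → ∀ X ∈ Xs x p, X c ∈ skewAdjoint (Matrix n n ℂ))
    (hsum : ∀ x ∈ W, ∑ p ∈ P x, |β| * (d x p + (s₁ x p + expTail₂ (m * a x p))) * (s₁ x p + expTail₂ (m * a x p))
      ≤ Hbar)
    {𝓔 : E𝔠 → ℝ}
    (hdict : ∀ x ∈ W, ∀ c : ℝ, 0 ≤ c → c ≤ 1 →
      𝓔 (c • x) = ∑ p ∈ P x, β * (1 - (Matrix.trace (Bf x p * (((Xs x p).map fun X => X (c : ℂ)).map exp).prod)).re /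
        Fintype.card n)) :
    ∀ x ∈ W, ∀ c : ℝ, 1 / 2 ≤ c → c ≤ 1 → 𝓔 (c • x) ≤ 𝓔 x + (1 - c) * (3 * Hbar / (R - 1)) := by
  refine hE_of_wilsonSquares P (fun x p w => Bf x p * (1 + plaquetteFn (Xs x p) w) - 1)
    (H := fun x p => d x p + (s₁ x p + expTail₂ (m * a x p))) (O := fun x p => s₁ x p + expTail₂ (m * a x p)) hR
    (fun x hx p hp => (((differentiableOn_const _).mul ((differentiableOn_const _).add
      (differentiableOn_plaquetteFn (hXd x hx p hp)))).sub_const 1))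
    (fun x hx p hp w hw => ?_) (fun x hx p hp w hw => ?_) hsum
    (fun x hx p hp c hc0 hc1 => one_add_curve_mul_conjTranspose (hBu x hx p hp) (hskew x hx p hp c hc0 hc1)) ?_
  · -- sup: `‖B − 1‖ + ‖P w‖`
    have h := norm_plaquetteFn_osc_le (Xs x p) (ha0 x hx p hp) (hlen x hx p hp) (hX0 x hx p hp) (ha x hx p hp)
      (hs x hx p hp)
    exact (norm_curve_le (hBu x hx p hp) _ w).1.trans (add_le_add (hBd x hx p hp) (h.2.1 w hw))
  · -- oscillation: the prefactor drops out
    have h := norm_plaquetteFn_osc_le (Xs x p) (ha0 x hx p hp) (hlen x hx p hp) (hX0 x hx p hp) (ha x hx p hp)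
      (hs x hx p hp)
    rw [(norm_curve_le (hBu x hx p hp) _ w).2]
    exact h.2.2 w hw
  · intro x hx c hc0 hc1
    rw [hdict x hx c hc0 hc1]
    refine Finset.sum_congr rfl fun p _ => ?_
    rw [add_sub_cancel, one_add_plaquetteFn]

end AbstractEnd

/-! ## §4 The chart-ray instance on the LD chain: the Wilson words of the Landau exponent field as square terms -/

section ChartRay

open scoped Matrix.Norms.L2Operator

variable {nM : Type*} [Fintype nM] [DecidableEq nM] [Nonempty nM]
variable {𝒴 𝒴' 𝒳 𝒵 ℬ : Type*} [NormedAddCommGroup 𝒴] [NormedSpace ℂ 𝒴] [CompleteSpace 𝒴]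
  [NormedAddCommGroup 𝒴'] [NormedSpace ℂ 𝒴'] [NormedAddCommGroup 𝒳] [NormedSpace ℂ 𝒳] [CompleteSpace 𝒳]
  [NormedAddCommGroup 𝒵] [NormedSpace ℂ 𝒵] [NormedAddCommGroup ℬ] [NormedSpace ℂ ℬ]
variable {n : ℕ} {𝒢 : 𝒵 →L[ℂ] 𝒴} {W𝒱 : 𝒴 → 𝒵} {B₀ C₄ a₃ : ℝ}

/-- **END-II's `hE` FOR THE WILSON PART ON THE LD CHAIN'S CHART RAYS — SQUARE TERMS** (the analogue of (B)
`hGW_landau_chartRay`, the Wilson words now read through `hE`).  Data: the chain's point∕ray binders VERBATIM; weight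
read-outs `ℓw p` with PER-PLAQUETTE op-norm constants `κ_w p` and — ONE MORE DISPLAYED binder — the CURL read-out norm
`‖((ℓw p).map (· Y)).sum‖ ≤ κ_c p·‖Y‖`; lengths `≤ m_w`; the real structure with SKEW weight read-outs (`hskew`, the chain's
(A)∕(E) reading: `ℓ Y ∈ 𝔲(N)` for `Y ∈ 𝓡𝒴`); the budget `Σ_{p∈P_w} |β|·H_p² ≤ H̄`, `H_p = κ_c p·z̄ + expTail₂(m_w κ_w p z̄)`,
`z̄ = (ε₄+B₀b) + 4C₂B₀(ε₄+B₀b)²`.  CONCLUSION — END-II's `hE` LITERALLY for the DEFINED Wilson ray profile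
`𝓔_W y := Σ_{p∈P_w} β·(1 − Re tr(holOf (ℓw p) Z y)∕N)`, `Z y = landauExp C ι H (4C₂(ε₄+B₀b)²) (solAt 𝒢 0 W𝒱 ε₄ 0 (H₁ Φ(cplx
y)) + H₁ Φ(cplx y))`, with `B_𝓔 = 3H̄∕(r_Φ∕S − 1)`, `H̄ ≥ Σ_p |β|(d_p + H_p)H_p` — SECOND ORDER per plaquette.  (§3 fired on the letter curves
`σ ↦ ℓ (Z_x σ)`: `landauCurve_along`, `rayData_chart`, `landauField_mem_real`, `solAt_zero_zero`∕`landauExp_zero` BY NAME.)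
[folklore] -/
theorem hE_landau_wilsonSquares {𝔭 : Type*} {W : Set (Fin n → ℝ)} {Pw : Finset 𝔭} {S : ℝ}
    (hS : 0 < S) (hWS : W ⊆ closedBall (0 : Fin n → ℝ) S)
    (h𝒢 : ∀ f, ‖𝒢 f‖ ≤ B₀ * ‖f‖) (hW : Prop4Hyp W𝒱 C₄ a₃) (hB₀ : 0 < B₀) (hC₄ : 0 ≤ C₄)
    {b ε₄ : ℝ} (hε₄ : 0 ≤ ε₄) (hdom : 2 * (ε₄ + B₀ * b) ≤ a₃)
    (hself : B₀ * C₄ * (ε₄ + B₀ * b) ^ 2 ≤ ε₄) (hcontr : 4 * B₀ * C₄ * (ε₄ + B₀ * b) < 1)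
    (H₁ : ℬ →L[ℂ] 𝒴) (hH₁ : ∀ B, ‖H₁ B‖ ≤ B₀ * ‖B‖)
    {Φ : (Fin n → ℂ) → ℬ} {rΦ : ℝ} (hΦd : DifferentiableOn ℂ Φ (ball 0 rΦ)) (hΦ0 : Φ 0 = 0)
    (hΦ : ∀ z ∈ ball (0 : Fin n → ℂ) rΦ, ‖Φ z‖ < b) (hSr : S < rΦ)
    {C : 𝒴' → 𝒳} {C₂ R : ℝ} (hC₂ : 0 ≤ C₂) (hCq : ∀ Z : 𝒴', ‖Z‖ < R → ‖C Z‖ ≤ C₂ * ‖Z‖ ^ 2)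
    (hCd : DifferentiableOn ℂ C (ball 0 R)) (ι : 𝒴 →L[ℂ] 𝒴') (hι : ∀ Y, ‖ι Y‖ ≤ ‖Y‖) (H : 𝒳 →L[ℂ] 𝒴)
    (hH : ∀ X, ‖H X‖ ≤ B₀ * ‖X‖) (hq : 9 * C₂ * B₀ * (ε₄ + B₀ * b) < 1) (hRC : 3 * (ε₄ + B₀ * b) ≤ R)
    -- weight read-outs: per-plaquette letter norms AND the curl read-out norm (DISPLAYED), lengths
    (ℓw : 𝔭 → List (𝒴 →L[ℂ] Matrix nM nM ℂ)) {κw κc : 𝔭 → ℝ} (hκw : ∀ p ∈ Pw, 0 ≤ κw p)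
    (hκc : ∀ p ∈ Pw, 0 ≤ κc p)
    (hℓw : ∀ p ∈ Pw, ∀ ℓ ∈ ℓw p, ∀ Y, ‖ℓ Y‖ ≤ κw p * ‖Y‖)
    (hcurl : ∀ p ∈ Pw, ∀ Y, ‖((ℓw p).map fun ℓ => ℓ Y).sum‖ ≤ κc p * ‖Y‖)
    {mw : ℕ} (hlenw : ∀ p ∈ Pw, (ℓw p).length ≤ mw)
    -- the real structure (chain (A)) with SKEW weight read-outs (chain (E))
    (𝓡𝒴 : AddSubgroup 𝒴) (h𝓡𝒴 : IsClosed (𝓡𝒴 : Set 𝒴)) (𝓡𝒵 : AddSubgroup 𝒵) (𝓡𝒴' : AddSubgroup 𝒴')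
    (𝓡𝒳 : AddSubgroup 𝒳) (h𝓡𝒳 : IsClosed (𝓡𝒳 : Set 𝒳)) (𝓡ℬ : AddSubgroup ℬ)
    (h𝒢r : ∀ f ∈ 𝓡𝒵, 𝒢 f ∈ 𝓡𝒴) (hWr : ∀ Y ∈ 𝓡𝒴, W𝒱 Y ∈ 𝓡𝒵) (hιr : ∀ Y ∈ 𝓡𝒴, ι Y ∈ 𝓡𝒴')
    (hHr : ∀ X ∈ 𝓡𝒳, H X ∈ 𝓡𝒴) (hCr : ∀ Z ∈ 𝓡𝒴', C Z ∈ 𝓡𝒳) (hH₁r : ∀ B ∈ 𝓡ℬ, H₁ B ∈ 𝓡𝒴)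
    (hΦr : ∀ y : Fin n → ℝ, ‖y‖ ≤ S → Φ (cplx y) ∈ 𝓡ℬ)
    (hskew : ∀ p ∈ Pw, ∀ ℓ ∈ ℓw p, ∀ Y ∈ 𝓡𝒴, ℓ Y ∈ skewAdjoint (Matrix nM nM ℂ))
    -- the frozen background plaquettes at the chart centre (N-ne7cp1-g31-2): unitary, `‖B_p − 1‖ ≤ d_p` (DISPLAYED)
    (Bp : 𝔭 → Matrix nM nM ℂ) {d : 𝔭 → ℝ} (hBu : ∀ p ∈ Pw, Bp p ∈ unitary (Matrix nM nM ℂ))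
    (hBd : ∀ p ∈ Pw, ‖Bp p - 1‖ ≤ d p)
    -- the budget, second order per plaquette
    {β Hbar : ℝ}
    (hsum : ∑ p ∈ Pw, |β| * (d p + (κc p * ((ε₄ + B₀ * b) + B₀ * (4 * C₂ * (ε₄ + B₀ * b) ^ 2)) +
        expTail₂ (mw * (κw p * ((ε₄ + B₀ * b) + B₀ * (4 * C₂ * (ε₄ + B₀ * b) ^ 2)))))) *
      (κc p * ((ε₄ + B₀ * b) + B₀ * (4 * C₂ * (ε₄ + B₀ * b) ^ 2)) +
        expTail₂ (mw * (κw p * ((ε₄ + B₀ * b) + B₀ * (4 * C₂ * (ε₄ + B₀ * b) ^ 2))))) ≤ Hbar) :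
    ∀ x ∈ W, ∀ c : ℝ, 1 / 2 ≤ c → c ≤ 1 →
      (fun y => ∑ p ∈ Pw, β * (1 - (Matrix.trace (Bp p * holOf (ℓw p) (fun y => landauExp C ι H
        (4 * C₂ * (ε₄ + B₀ * b) ^ 2) (solAt 𝒢 0 W𝒱 ε₄ (0 : 𝒵) (H₁ (Φ (cplx y))) + H₁ (Φ (cplx y)))) y)).re /
          Fintype.card nM)) (c • x) ≤
      (fun y => ∑ p ∈ Pw, β * (1 - (Matrix.trace (Bp p * holOf (ℓw p) (fun y => landauExp C ι H
        (4 * C₂ * (ε₄ + B₀ * b) ^ 2) (solAt 𝒢 0 W𝒱 ε₄ (0 : 𝒵) (H₁ (Φ (cplx y))) + H₁ (Φ (cplx y)))) y)).re /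
          Fintype.card nM)) x +
        (1 - c) * (3 * Hbar / (rΦ / S - 1)) := by
  set zbar : ℝ := (ε₄ + B₀ * b) + B₀ * (4 * C₂ * (ε₄ + B₀ * b) ^ 2) with hzbar
  -- the chain's curve along the chart ray
  set Zc : (Fin n → ℝ) → ℂ → 𝒴 := fun x σ =>
    landauExp C ι H (4 * C₂ * (ε₄ + B₀ * b) ^ 2)
      (solAt 𝒢 0 W𝒱 ε₄ (0 : 𝒵) (H₁ (Φ (σ • cplx x))) + H₁ (Φ (σ • cplx x))) with hZc
  have hRad1 : 1 < rΦ / S := by rw [lt_div_iff₀ hS]; linarith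
  have hRad : 0 < rΦ / S := one_pos.trans hRad1
  have hb : 0 < b := (norm_nonneg _).trans_lt (hΦ 0 (mem_ball_self (hS.trans hSr)))
  have ha : 0 < B₀ * b := mul_pos hB₀ hb
  have hz : 0 ≤ zbar := by rw [hzbar]; positivity
  have hΛ : ∀ Y : 𝒴, ‖(0 : 𝒴 →L[ℂ] 𝒴) Y‖ ≤ 0 * ‖Y‖ := fun Y => by simp
  have hself' : B₀ * 0 + 0 * (ε₄ + B₀ * b) + B₀ * C₄ * (ε₄ + B₀ * b) ^ 2 ≤ ε₄ := by simpa using hself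
  have hcontr' : 0 + 4 * B₀ * C₄ * (ε₄ + B₀ * b) < 1 := by simpa using hcontr
  have hray := fun x (hx : x ∈ W) =>
    rayData_chart H₁ hH₁ hB₀ hΦd hΦ0 hΦ hS (mem_closedBall_zero_iff.1 (hWS hx))
  have hcurve : ∀ x ∈ W, DifferentiableOn ℂ (Zc x) (ball 0 (rΦ / S)) ∧
      ∀ σ ∈ ball (0 : ℂ) (rΦ / S), ‖Zc x σ‖ ≤ zbar := fun x hx =>
    landauCurve_along h𝒢 hΛ hW hB₀.le hC₄ le_rfl hε₄ hdom hself' hcontr' hRad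
      (currentData_zero (𝒵 := 𝒵) (rΦ / S)).1 (hray x hx).1 (currentData_zero (𝒵 := 𝒵) (rΦ / S)).2.1
      (hray x hx).2.2.1 rfl (hray x hx).2.1 hC₂ hCq hCd ι hι H hH hq hRC
  -- the flat centre: `Zc x 0 = 0`
  have hε4a : 0 < ε₄ + B₀ * b := by linarith
  have hZ0 : ∀ x, Zc x 0 = 0 := fun x => by
    simp only [hZc, zero_smul, hΦ0, map_zero]
    rw [solAt_zero_zero h𝒢 hΛ hW hB₀.le hC₄ le_rfl hε₄ ha hdom hself' hcontr', zero_add]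
    exact landauExp_zero hC₂ hCq hCd hι hB₀.le hH hq hRC hε4a
  -- real chart points of the window: the exponent field is real, the weight letters skew
  have hreal : ∀ x ∈ W, ∀ c : ℝ, 0 ≤ c → c ≤ 1 → ∀ p ∈ Pw, ∀ ℓ ∈ ℓw p,
      ℓ (Zc x (c : ℂ)) ∈ skewAdjoint (Matrix nM nM ℂ) := by
    intro x hx c hc0 hc1 p hp ℓ hℓ
    have hy : ‖c • x‖ ≤ S := by
      rw [norm_smul, Real.norm_of_nonneg hc0]
      exact (mul_le_of_le_one_left (norm_nonneg _) hc1).trans (mem_closedBall_zero_iff.1 (hWS hx))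
    have hmem := landauField_mem_real h𝒢 hW hB₀ hC₄ hε₄ hdom hself hcontr H₁ hH₁ hΦ hSr hC₂ hCq hCd ι hι H hH hq hRC
      𝓡𝒴 h𝓡𝒴 𝓡𝒵 𝓡𝒴' 𝓡𝒳 h𝓡𝒳 𝓡ℬ h𝒢r hWr hιr hHr hCr hH₁r hΦr hy
    have e : Zc x (c : ℂ) = landauExp C ι H (4 * C₂ * (ε₄ + B₀ * b) ^ 2)
        (solAt 𝒢 0 W𝒱 ε₄ (0 : 𝒵) (H₁ (Φ (cplx (c • x)))) + H₁ (Φ (cplx (c • x)))) := by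
      simp only [hZc, ofReal_smul_cplx]
    rw [e]
    exact hskew p hp ℓ hℓ _ hmem
  -- §3 on the letter curves `σ ↦ ℓ (Zc x σ)`
  refine hE_of_wilsonPlaquettes (fun _ => Pw) (fun _ p => Bp p) (fun x p => (ℓw p).map fun ℓ => fun σ => ℓ (Zc x σ))
    (R := rΦ / S) (β := β) (Hbar := Hbar) (d := fun _ p => d p) (a := fun _ p => κw p * zbar)
    (s₁ := fun _ p => κc p * zbar) (m := mw) hRad1 (fun x _ p hp => hBu p hp) (fun x _ p hp => hBd p hp)
    (fun x _ p hp => by simpa using hlenw p hp) (fun x hx p hp X hX => ?_) (fun x hx p hp X hX => ?_)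
    (fun x _ p hp => mul_nonneg (hκw p hp) hz) (fun x hx p hp X hX w hw => ?_) (fun x hx p hp w hw => ?_)
    (fun x hx p hp c hc0 hc1 X hX => ?_) (fun x _ => by simpa [hzbar] using hsum)
    (𝓔 := fun y => ∑ p ∈ Pw, β * (1 - (Matrix.trace (Bp p * holOf (ℓw p) (fun y => landauExp C ι H
        (4 * C₂ * (ε₄ + B₀ * b) ^ 2) (solAt 𝒢 0 W𝒱 ε₄ (0 : 𝒵) (H₁ (Φ (cplx y))) + H₁ (Φ (cplx y)))) y)).re /
          Fintype.card nM))
    (fun x hx c hc0 hc1 => ?_)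
  · -- holomorphy of a letter curve
    obtain ⟨ℓ, -, rfl⟩ := List.mem_map.1 hX
    exact ℓ.differentiable.comp_differentiableOn (hcurve x hx).1
  · -- vanishing at the flat centre
    obtain ⟨ℓ, -, rfl⟩ := List.mem_map.1 hX
    simp [hZ0 x]
  · -- per-letter bound
    obtain ⟨ℓ, hℓ, rfl⟩ := List.mem_map.1 hX
    exact (hℓw p hp ℓ hℓ _).trans (mul_le_mul_of_nonneg_left ((hcurve x hx).2 w hw) (hκw p hp))
  · -- the curl bound
    have e : ((((ℓw p).map fun ℓ => fun σ => ℓ (Zc x σ)).map fun X => X w)) = (ℓw p).map fun ℓ => ℓ (Zc x w) := by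
      rw [List.map_map]; rfl
    rw [e]
    exact (hcurl p hp _).trans (mul_le_mul_of_nonneg_left ((hcurve x hx).2 w hw) (hκc p hp))
  · -- skew letters on the real segment
    obtain ⟨ℓ, hℓ, rfl⟩ := List.mem_map.1 hX
    exact hreal x hx c hc0 hc1 p hp ℓ hℓ
  · -- the dictionary: the word of exponentials of the letter values IS `holOf (ℓw p) Z (c • x)`
    refine Finset.sum_congr rfl fun p _ => ?_
    have e : ((((ℓw p).map fun ℓ => fun σ => ℓ (Zc x σ)).map fun X => X (c : ℂ)).map exp).prod =
        holOf (ℓw p) (fun y => landauExp C ι H (4 * C₂ * (ε₄ + B₀ * b) ^ 2)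
          (solAt 𝒢 0 W𝒱 ε₄ (0 : 𝒵) (H₁ (Φ (cplx y))) + H₁ (Φ (cplx y)))) (c • x) := by
      simp only [holOf_apply, wordExp, List.map_map, Function.comp_def, hZc, ofReal_smul_cplx]
    rw [e]

end ChartRay

/-! ## §5 Two ray bounds add -/

section Add

variable {E𝔠 : Type*} [AddCommGroup E𝔠] [Module ℝ E𝔠]

/-- **`hE` IS ADDITIVE**: ray bounds for `𝓔₁` (constant `B₁`) and `𝓔₂` (constant `B₂`) give the ray bound for `𝓔₁ + 𝓔₂`
with `B₁ + B₂` — the Wilson squares (§4) plus the genuine non-Wilson terms (S71 `hE_of_pinned_terms` ∕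
`hE_landau_chartRay_pinned`, or (D) `hE_landau_chartRay`) enter (C) `slotAC_realized_su2_landauChart_twoSided` ∕ S70 f4 as
ONE pair; `0 ≤ B₁ + B₂` from the two `hB𝓔`. [folklore] -/
theorem hE_add {W : Set E𝔠} {𝓔₁ 𝓔₂ : E𝔠 → ℝ} {B₁ B₂ : ℝ}
    (h₁ : ∀ x ∈ W, ∀ c : ℝ, 1 / 2 ≤ c → c ≤ 1 → 𝓔₁ (c • x) ≤ 𝓔₁ x + (1 - c) * B₁)
    (h₂ : ∀ x ∈ W, ∀ c : ℝ, 1 / 2 ≤ c → c ≤ 1 → 𝓔₂ (c • x) ≤ 𝓔₂ x + (1 - c) * B₂) :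
    ∀ x ∈ W, ∀ c : ℝ, 1 / 2 ≤ c → c ≤ 1 →
      (fun y => 𝓔₁ y + 𝓔₂ y) (c • x) ≤ (fun y => 𝓔₁ y + 𝓔₂ y) x + (1 - c) * (B₁ + B₂) := by
  intro x hx c hc hc1
  have e1 := h₁ x hx c hc hc1
  have e2 := h₂ x hx c hc hc1
  simp only
  linarith

/-- … and the nonnegativity of the summed constant. [folklore] -/
theorem hB𝓔_add {B₁ B₂ : ℝ} (h₁ : 0 ≤ B₁) (h₂ : 0 ≤ B₂) : 0 ≤ B₁ + B₂ := add_nonneg h₁ h₂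

end Add

end Summit.QuantumFields.BalabanUV.T4Continuum.ShellMeasureLandauWilsonSquares

end
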